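import Literature.MathematicalPhysics.QuantumFieldTheory.Balaban1983to89.B1Eq214Concrete
import Literature.MathematicalPhysics.QuantumFieldTheory.Balaban1983to89.B2Eq328DeltaK

/-!
# `Balaban1983to89.B2Eq322Composition` — [Balaban1982Higgs2] §3.B p. 588, the step (3.21) → (3.22)/(3.23): **THE
LOCALIZED COMPOSITION OF THE SINGLE-STEP RENORMALIZATION TRANSFORMATIONS, PROVED ON THE CONCRETE (Higgs)₂,₃ CARRIER** —
for a region `Λ ⊂ T⁽ᵏ⁾`, composing the `k` single-step Gaussian kernels `t_{a(Lʲ⁺¹ε)^{d−2}}(φ_{j+1}(z) − (Q(Ã)φ_j)(z))`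
((I.2.5)–(I.2.7)) LOCALIZED in the tower `Λ ← B(Λ) ← B²(Λ) ← … ← Bᵏ(Λ)`, i.e. integrating the intermediate fields
`φ₁, …, φ_{k−1}` over the blocks `B^{k−1}(Λ), …, B¹(Λ)` only, gives EXACTLY the one-stroke kernel
`Π_{y∈Λ} t_{a_k(Lᵏε)^{d−2}}(φ_k(y) − (Q_k(Ã)φ₀)(y))` of (I.2.10)/(I.2.16) on `Λ` (`chain_eq_kerK`); consequently the
integrand of (3.23) (gen 4's `B2Eq337ScalarIntegration.dens`, whose kernel factors were WRITTEN as one-stroke kernels) IS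
the product over the regions `Λ_k` of these localized compositions (`dens_eq_prod_chain`, `F325_eq_integral_chain`) — the
sentence the six §3.B files of this seat carried as «the (3.21) → (3.22) composition is not constructed»

statement-level skeleton of published theorems with citation tags; proofs where landed; nothing here is a claim about the Yang–Mills mass gap

CITATION HEADER.  T. Bałaban, *(Higgs)₂,₃ quantum fields in a finite volume. II. An upper bound*, Commun. Math. Phys. **86**
(1982) 555–594 [Balaban1982Higgs2] (cell paper B2; PDF held `paper:balaban1982-cmp86-higgs23-ii`, journal page = PDF page + 554;
p. 588 [PDF 34] re-read this gen on the text layer `p0034.txt` and, gens 4/6, AS IMAGE on the ×2 render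
`run/shared/lean/pub/pub-balaban/b2b-balaban-ref1/pages/1982-cmp86-higgs23-II/1982-cmp86-higgs23-II-p034-x2.png`); T. Bałaban,
*(Higgs)₂,₃ quantum fields in a finite volume. I. A lower bound*, Commun. Math. Phys. **85** (1982) 603–626 [Balaban1982Higgs1]
((2.2), (2.5)–(2.7) p. 608, (2.10)–(2.16) p. 609).  Unit `lit-balaban-p15` gen 7 (Phase-2 proof seat p15; HOME
`run/shared/lean/pub/lit-balaban/`), second target of the gen.  SKELETON rows **B2.Eq3.25** ((3.21)–(3.25): *"composition of
the localized renormalization transformations via (I.2.12) (3.21)–(3.23)"*; fold owner r02, second reader r14, referee ref-4)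
and, by name, B1.Eq2.14 / B1.Eq2.16 (the GLOBAL laws, r14: `B1RTSemigroup.display214`, `B1Eq214Concrete.renormTransf_renormTransfK`,
`renormChain_eq_renormTransfK`).  USED BY NAME (nothing restated): r14's `B1RTSemigroup.{qAvg, integral_blockKernel_mul_prod_rtKernel}`
((I.2.12) block by block over a product `Z × B`), `B1Eq214Concrete.{blockSite, posInBlock, blockOf_blockSite, posInBlock_blockSite,
blockSite_blockOf_posInBlock, sum_block_eq_sum_blockSite, uQ, uQ_apply, compPrec_model, avgQk_one}`, `HiggsAveragingCompose.avgQ_avgQk`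
(`Q(Ã)Q_k(Ã) = Q_{k+1}(Ã)`), the typer's `HiggsLattice.{block, blockSet, blockOf}`, `HiggsAveraging.{avgQ, avgQk, holQ}`,
`B1RT.{rtKernel, prec}`, `B1.aSeq_one`; gen 4's `B2Eq337ScalarIntegration.{Regions, Cfg, InCfg, field, precAt, qMean, qMean_eq_avgQk,
gField, dens, F325}`, `B2Eq328ConcretePieces.resL`, `B2Eq328DeltaK.extL`.

THE SOURCE TEXT (p. 588, verbatim).  *"We will estimate at first the internal integral over the scalar fields. Let us consider
the expression in the curly bracket {…}. We will transform it in a similar way as in Sect. A, i.e. we compose the renormalization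
transformations localized in the sets Λ₅⁽ᵏ⁻¹⁾′∩Λ₅⁽ᵏ⁾ᶜ ⊂ T⁽ᵏ⁾_{Lᵏε}, integrating over the fields φ₁, …, φ_{k−1} localized suitably
in the sets B^{k−1}(Λ₅⁽ᵏ⁻¹⁾′∩Λ₅⁽ᵏ⁾ᶜ), …, B¹(Λ₅⁽ᵏ⁻¹⁾′∩Λ₅⁽ᵏ⁾ᶜ). After these compositions the expression transforms into the
following form (3.22). Now let us consider the expression standing on the right of the characteristic functions. … Let us
write it explicitly, omitting the constants in the definition of renormalization transformations: ∫dφ↾_{Λ₅⁽⁰⁾} exp[−½ Σ_{k=1}^{K}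
a_k(Lᵏε)^{d−2} Σ_{x_k∈Λ₅⁽ᵏ⁻¹⁾′∩Λ₅⁽ᵏ⁾ᶜ} |φ_k(x_k) − (Q_k(Ã^ε)φ₀)(x_k)|² − ½⟨φ₀, (−Δ^ε_{Ã^ε} + m²)φ₀⟩], (3.23)"*.  The same
composition in Sect. A, p. 584 (v1.1, verbatim): *"All the partial renormalization transformations defined on the sets
B^{l−j}(Λ₋₁⁽ˡ⁻¹⁾∩Λ₅⁽ˡ⁾ᶜ), k ≦ j < l, can be composed according to formula (I.2.12) of Chap. I.2. We have to notice that the vector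
fields, with respect to which the integration is done when the composition is formed, do not occur in the correspondingly localized
configuration Ã^{(k),ε}."* — and the composed exponent (3.7) p. 584 carries ONE field for all levels: *"− Σ_{l=k+1}^{K} ½a_{l−k}(L^{l−k})^{d−2}
Σ_{x_l∈Λ₅⁽ˡ⁻¹⁾′∩Λ₅⁽ˡ⁾ᶜ} |φ_l(x_l) − (Q_{l−k}(Ã^{(k+1)})φ_k)(x_l)|²"*.  [I] p. 609:
*"∫dθ exp{−½α|ψ − L^{−d}Σ_{y∈B(x)} U_yθ(y)|² − ½β Σ_{y∈B(x)}|θ(y) − φ(y)|²} = const exp{−½ αβ/(β + L^{−d}α) |ψ − L^{−d}Σ_{y∈B(x)}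
U_yφ(y)|²}, (2.12) … T^{Lᵏε}_{a,L,A}T^ε_{a_k,Lᵏ,A} = T^ε_{a_{k+1},L^{k+1},A}. (2.14) … T^{L^{k−1}ε}_{a,L,A} … T^{Lε}_{a,L,A}T^ε_{a,L,A}
= T^ε_{a_k,Lᵏ,A}. (2.16)"*.

DICTIONARY (print ↦ Lean).  The single-step kernel of `T^{Lʲε}_{a,L,Ã}` LOCALIZED in `Λ ⊂ T⁽ʲ⁺¹⁾` ↦ `stepKer C a A Λ ψ θ =
Π_{z∈Λ} t_{a(Lʲ⁺¹ε)^{d−2}}(ψ(z) − (Q(Ã)θ)(z))` (it reads `θ` on `B(Λ)` only); the one-stroke kernel of `T^ε_{a_k,Lᵏ,Ã}`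
LOCALIZED in `Λ ⊂ T⁽ᵏ⁾` ↦ `kerK C a A k Λ ψ φ₀ = Π_{y∈Λ} t_{a_k(Lᵏε)^{d−2}}(ψ(y) − (Q_k(Ã)φ₀)(y))` (= the factor of (3.23) for
`Λ = Λ_k`, precision `precAt P a k`); «integrating over the field φ_j localized in B^{k−j}(Λ)» ↦ the Lebesgue integral over the
block coordinates `g : Λ′ × {0,…,L−1}^d → ℝ^N` of the field on `B(Λ′)` (`place Λ′ g`, (I.1.17)), `Λ′ = B^{k−j−1}(Λ)`; the
composition ↦ `chain C a A k Λ ψ φ₀` (`k+1` single steps from `φ₀`, defined by recursion: `chain 0 Λ ψ φ₀ = stepKer Λ ψ φ₀`,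
`chain (k+1) Λ ψ φ₀ = ∫dg stepKer Λ ψ (place g) · chain k (B(Λ)) (place g) φ₀`).

WHAT THIS MODULE PROVES (kernel-checked, 0 `sorry`, standard axioms; defs `stepKer`, `kerK`, `place`, `chain` with bodies).
§1 block coordinates of `B(Λ)`: `place_blockSite`, `prod_block_eq_prod_blockSite`, `prod_blockSet_eq`, `avgQ_place` (Q(Ã) of a
   placed field = r14's `qAvg` with the transports `uQ`), `qAvg_uQ_eq_avgQ`.
§2 **`stepKer_integral_kerK`** (the localized semigroup law (I.2.14): `∫dg stepKer Λ ψ (place g) · kerK (k+1) (B(Λ)) (place g) φ₀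
   = kerK (k+2) Λ ψ φ₀`, `k+1 < K_lattice`), **`chain_eq_kerK`** (the localized (I.2.16): `chain k Λ ψ φ₀ = kerK (k+1) Λ ψ φ₀` for
   `k+1 ≤` the number of scales of the lattice family).
§3 **`prod_blockSite_eq_prod_kerK`**, **`dens_eq_prod_chain`** (the integrand of (3.23) WITH constants = `Π_{k=1}^{K} chain (k−1) Λ_k
   (φ_k↾Λ_k) φ₀ · exp(−½⟨φ₀,(−Δ_Ã + m²)φ₀⟩)`), **`F325_eq_integral_chain`** ((3.25)'s left side as the integral of the composed
   localized single-step kernels: the (3.21) → (3.22) composition on the concrete carrier).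
§4 (v1.1) `spread`, `kerK_spread` (= r14's `B1RT.blockKernel` over the sites of `Λ`), **`integral_kerK_spread`**,
   **`integral_chain_spread`** (the normalization (I.2.8)/(3.32): `∫dφ↾_Λ kerK = 1`, `∫dφ↾_Λ chain = 1`).
HONEST SCOPE.  (i) ONE external field `Ã` at every step, as in the print's composed formulas (3.7) (`Ã^{(k+1)}` at every
level) and (3.23) (`Ã^ε`): in (3.5)/(3.21) the step-`j` transformation is written `T_{a,L,Ã^{(j),ε}}` with the field (3.4), and the
identification of these fields on the localized sets (the cut-offs `θ` of (3.2)–(3.4)) is the print's, NOT formalized here (the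
theorem is stated for any one `Ã`; formula (I.2.12) itself holds for arbitrary isometric transports).  (ii) «localized suitably»: the intermediate field
`φ_j` is integrated exactly over `B^{k−j}(Λ)` in block coordinates; no characteristic function acts on it (p. 588: none remain there).
(iii) Levels `≤` the number of scales of the lattice family (honest block maps, as in r14's global (2.14)/(2.16)).  (iv) The curly
bracket of (3.21) itself (the nested single-step integrals WITH the characteristic functions and the densities `ρ′`) is not
constructed; what is proved is the kernel identity that the sentence invokes, and its knit with (3.23).  Value = the published
composition step behind (3.22)/(3.23), formalized; NOT summit progress.
-/

noncomputable section

open MeasureTheory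
open scoped BigOperators

namespace Literature.MathematicalPhysics.QuantumFieldTheory.Balaban1983to89.B2Eq322Composition

open Literature.MathematicalPhysics.QuantumFieldTheory.Balaban1983to89.HiggsLattice
open Literature.MathematicalPhysics.QuantumFieldTheory.Balaban1983to89.HiggsAveraging
open Literature.MathematicalPhysics.QuantumFieldTheory.Balaban1983to89.B1RT
open Literature.MathematicalPhysics.QuantumFieldTheory.Balaban1983to89.B1RTSemigroup (qAvg qAvg_apply
  integral_blockKernel_mul_prod_rtKernel)
open Literature.MathematicalPhysics.QuantumFieldTheory.Balaban1983to89.B1Eq214Concrete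
open Literature.MathematicalPhysics.QuantumFieldTheory.Balaban1983to89.B2Eq337ScalarIntegration
open Literature.MathematicalPhysics.QuantumFieldTheory.Balaban1983to89.B2Eq328ConcretePieces (resL LSite)
open Literature.MathematicalPhysics.QuantumFieldTheory.Balaban1983to89.B2Eq328DeltaK (extL)

variable {P : HiggsLattice.Params} {N : ℕ}

/-! ## §1  Block coordinates of `B(Λ) ⊂ T⁽ᵏ⁾` for a region `Λ ⊂ T⁽ᵏ⁺¹⁾` -/

section Blocks

variable {k : ℕ}

/-- The block coordinates of `B(Λ)`: (a site of `Λ`, a position in `{0,…,L−1}^d`) ((I.1.17): `x_μ = Lz_μ + r_μ`).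
[cite: Balaban1982Higgs1, (1.17)–(1.18) pp.606–607] -/
abbrev BlkIdx (Λ : Finset (HiggsLattice.Site P (k + 1))) : Type := ↥Λ × (Fin P.d → Fin P.L)

/-- A field on `B(Λ)` given in block coordinates, PLACED on `T⁽ᵏ⁾` (extended by `0` off `B(Λ)`; nothing below reads it
there). [cite: Balaban1982Higgs2, (3.22)–(3.23) p.588, dictionary] [cite: Balaban1982Higgs1, (1.17) p.606] -/
def place (Λ : Finset (HiggsLattice.Site P (k + 1))) (g : BlkIdx Λ → V N) : HiggsLattice.ScalarField P k N :=
  fun x => if h : HiggsLattice.blockOf x ∈ Λ then g (⟨HiggsLattice.blockOf x, h⟩, posInBlock x) else 0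

/-- The placed field at the site of `B(z)` with position `r` is `g(z, r)` (`k <` the number of scales).
[cite: Balaban1982Higgs1, (1.17) p.606] -/
theorem place_blockSite (hk : k < P.K) (Λ : Finset (HiggsLattice.Site P (k + 1))) (g : BlkIdx Λ → V N) (z : ↥Λ)
    (r : Fin P.d → Fin P.L) : place Λ g (blockSite z.1 r) = g (z, r) := by
  unfold place
  have hb : HiggsLattice.blockOf (blockSite z.1 r) = z.1 := blockOf_blockSite hk z.1 r
  have hmem : HiggsLattice.blockOf (blockSite z.1 r) ∈ Λ := by rw [hb]; exact z.2
  rw [dif_pos hmem]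
  congr 1
  ext1
  · exact Subtype.ext hb
  · exact posInBlock_blockSite hk z.1 r

/-- `B(z)` as the image of the positions, product form: `Π_{x∈B(z)} F(x) = Π_r F(blockSite z r)` (r14's
`sum_block_eq_sum_blockSite`, multiplicatively). [cite: Balaban1982Higgs1, (1.17) p.606] -/
theorem prod_block_eq_prod_blockSite (hk : k < P.K) (z : HiggsLattice.Site P (k + 1)) (F : HiggsLattice.Site P k → ℝ) :
    ∏ x ∈ HiggsLattice.block z, F x = ∏ r : Fin P.d → Fin P.L, F (blockSite z r) := by
  have himage : HiggsLattice.block z = Finset.univ.image (blockSite z) := by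
    ext x
    simp only [HiggsLattice.block, Finset.mem_filter, Finset.mem_univ, true_and, Finset.mem_image]
    constructor
    · intro hx
      exact ⟨posInBlock x, by rw [← hx, blockSite_blockOf_posInBlock hk x]⟩
    · rintro ⟨r, rfl⟩
      exact blockOf_blockSite hk z r
  rw [himage, Finset.prod_image]
  intro r _ r' _ h
  rw [← posInBlock_blockSite hk z r, h, posInBlock_blockSite hk z r']

/-- `B(Λ)` in block coordinates: `Π_{x∈B(Λ)} F(x) = Π_{(z,r)} F(blockSite z r)` (the blocks of distinct sites are disjoint).
[cite: Balaban1982Higgs1, (1.18) p.607] -/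
theorem prod_blockSet_eq (hk : k < P.K) (Λ : Finset (HiggsLattice.Site P (k + 1))) (F : HiggsLattice.Site P k → ℝ) :
    ∏ x ∈ HiggsLattice.blockSet Λ, F x = ∏ p : BlkIdx Λ, F (blockSite p.1.1 p.2) := by
  have hfib : ∏ z ∈ Λ, ∏ x ∈ (HiggsLattice.blockSet Λ).filter (fun x => HiggsLattice.blockOf x = z), F x = ∏ x ∈ HiggsLattice.blockSet Λ, F x :=
    Finset.prod_fiberwise_of_maps_to (fun x hx => (Finset.mem_filter.1 hx).2) F
  rw [← hfib, Fintype.prod_prod_type, ← Finset.prod_coe_sort Λ]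
  refine Finset.prod_congr rfl fun z _ => ?_
  have hfil : (HiggsLattice.blockSet Λ).filter (fun x => HiggsLattice.blockOf x = z.1) = HiggsLattice.block z.1 := by
    ext x
    simp only [HiggsLattice.blockSet, HiggsLattice.block, Finset.mem_filter, Finset.mem_univ, true_and]
    constructor
    · exact fun h => h.2
    · intro h
      exact ⟨by rw [h]; exact z.2, h⟩
  rw [hfil, prod_block_eq_prod_blockSite hk]

variable (C : HiggsLattice.ChargeData N) (A : HiggsLattice.VecField P 0)

/-- **`Q(Ã)` of a placed field, at a site of `Λ`, is r14's product-model average `qAvg` with weight `L^{−d}` and the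
transports `U(Ã(Γ_{z,x}))` (`uQ`)** ((I.2.7) in block coordinates). [cite: Balaban1982Higgs1, (2.7) p.608] -/
theorem avgQ_place (hk : k < P.K) (Λ : Finset (HiggsLattice.Site P (k + 1))) (g : BlkIdx Λ → V N) (z : ↥Λ) :
    avgQ C A (place Λ g) z.1 = qAvg (((P.L : ℝ) ^ P.d)⁻¹) (fun p : BlkIdx Λ => uQ C A (p.1.1, p.2)) g z := by
  rw [avgQ_apply, qAvg_apply, sum_block_eq_sum_blockSite hk]
  congr 1
  refine Finset.sum_congr rfl fun r _ => ?_
  rw [place_blockSite hk Λ g z r, uQ_apply]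
  rfl

/-- `L^{−d}Σ_r U(Ã(Γ_{z,(z,r)}))f(blockSite z r) = (Q(Ã)f)(z)` for any field `f` on `T⁽ᵏ⁾` (the same dictionary, read
backwards). [cite: Balaban1982Higgs1, (2.7) p.608] -/
theorem qAvg_uQ_eq_avgQ (hk : k < P.K) (z : HiggsLattice.Site P (k + 1)) (f : HiggsLattice.ScalarField P k N) :
    (((P.L : ℝ) ^ P.d)⁻¹) • ∑ r : Fin P.d → Fin P.L, uQ C A (z, r) (f (blockSite z r)) = avgQ C A f z := by
  rw [avgQ_apply, sum_block_eq_sum_blockSite hk]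
  congr 1

end Blocks

/-! ## §2  The localized kernels and the localized semigroup / composition laws -/

section Kernels

variable (C : HiggsLattice.ChargeData N) (a : ℝ) (A : HiggsLattice.VecField P 0)

/-- **The single-step renormalization kernel LOCALIZED in `Λ ⊂ T⁽ᵏ⁺¹⁾`**: `Π_{z∈Λ} t_{a(Lᵏ⁺¹ε)^{d−2}}(ψ(z) − (Q(Ã)θ)(z))`
(the factors of (I.2.5)–(I.2.6) over the sites of `Λ`; `t_κ(v) = (κ/2π)^{N/2}e^{−½κ|v|²}`; reads `θ` on `B(Λ)` only).
[cite: Balaban1982Higgs1, (2.5)–(2.7) p.608] [cite: Balaban1982Higgs2, (3.21) p.588] -/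
def stepKer {k : ℕ} (Λ : Finset (HiggsLattice.Site P (k + 1))) (ψ : HiggsLattice.ScalarField P (k + 1) N) (θ : HiggsLattice.ScalarField P k N) : ℝ :=
  ∏ z ∈ Λ, rtKernel (prec a (P.mesh (k + 1)) P.d) (ψ z - avgQ C A θ z)

/-- **The `k`-th order (one-stroke) kernel LOCALIZED in `Λ ⊂ T⁽ᵏ⁾`**: `Π_{y∈Λ} t_{a_k(Lᵏε)^{d−2}}(ψ(y) − (Q_k(Ã)φ₀)(y))` —
the factor of (3.23) for the region `Λ_k = Λ` (precision `precAt P a k`, gen 4). [cite: Balaban1982Higgs1, (2.10) p.609]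
[cite: Balaban1982Higgs2, (3.23) p.588] -/
def kerK (k : ℕ) (Λ : Finset (HiggsLattice.Site P k)) (ψ : HiggsLattice.ScalarField P k N) (φ₀ : HiggsLattice.ScalarField P 0 N) : ℝ :=
  ∏ y ∈ Λ, rtKernel (precAt P a k) (ψ y - avgQk C A k φ₀ y)

/-- **The COMPOSITION of the single-step transformations localized in the tower over `Λ ⊂ T⁽ᵏ⁺¹⁾`**: `k+1` steps from
`φ₀`; the intermediate field of level `j` is integrated over `B^{k+1−j}(Λ)` in block coordinates (p. 588: *"integrating over
the fields φ₁, …, φ_{k−1} localized suitably in the sets B^{k−1}(Λ), …, B¹(Λ)"*). [cite: Balaban1982Higgs2, (3.21)–(3.22) p.588]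
[cite: Balaban1982Higgs1, (2.16) p.609] -/
def chain : (k : ℕ) → Finset (HiggsLattice.Site P (k + 1)) → HiggsLattice.ScalarField P (k + 1) N → HiggsLattice.ScalarField P 0 N → ℝ
  | 0, Λ, ψ, φ₀ => stepKer C a A Λ ψ φ₀
  | k + 1, Λ, ψ, φ₀ => ∫ g : BlkIdx Λ → V N,
      stepKer C a A Λ ψ (place Λ g) * chain k (HiggsLattice.blockSet Λ) (place Λ g) φ₀

variable {C a A}

/-- Unfolding of the recursion, base. [cite: Balaban1982Higgs2, (3.21)–(3.22) p.588] -/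
theorem chain_zero (Λ : Finset (HiggsLattice.Site P 1)) (ψ : HiggsLattice.ScalarField P 1 N) (φ₀ : HiggsLattice.ScalarField P 0 N) :
    chain C a A 0 Λ ψ φ₀ = stepKer C a A Λ ψ φ₀ := rfl

/-- Unfolding of the recursion, step. [cite: Balaban1982Higgs2, (3.21)–(3.22) p.588] -/
theorem chain_succ (k : ℕ) (Λ : Finset (HiggsLattice.Site P (k + 2))) (ψ : HiggsLattice.ScalarField P (k + 2) N) (φ₀ : HiggsLattice.ScalarField P 0 N) :
    chain C a A (k + 1) Λ ψ φ₀
      = ∫ g : BlkIdx Λ → V N, stepKer C a A Λ ψ (place Λ g) * chain C a A k (HiggsLattice.blockSet Λ) (place Λ g) φ₀ := rfl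

/-- `kerK` at `k = 1` is the single-step kernel from `φ₀` (`a₁ = a`, `Q₁(Ã) = Q(Ã)`: r14's `B1.aSeq_one`, `avgQk_one`).
[cite: Balaban1982Higgs1, (2.15)–(2.16) p.609] -/
theorem kerK_one (hL : 1 < P.L) (Λ : Finset (HiggsLattice.Site P 1)) (ψ : HiggsLattice.ScalarField P 1 N) (φ₀ : HiggsLattice.ScalarField P 0 N) :
    kerK C a A 1 Λ ψ φ₀ = stepKer C a A Λ ψ φ₀ := by
  have hL' : (1 : ℝ) < P.L := by exact_mod_cast hL
  unfold kerK stepKer precAt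
  rw [B1.aSeq_one hL', avgQk_one]

/-- **THE LOCALIZED SEMIGROUP LAW (I.2.14)**: for `Λ ⊂ T⁽ᵏ⁺²⁾` (`k+1 <` the number of scales, `a > 0`, `L > 1`),
integrating the field of level `k+1` over `B(Λ)` (block coordinates) against the localized single-step kernel on `Λ` and the
localized `(k+1)`-st order kernel on `B(Λ)` gives the localized `(k+2)`-nd order kernel on `Λ`:
`∫dg Π_{z∈Λ}t_{a(Lᵏ⁺²ε)^{d−2}}(ψ(z) − (Q(Ã)g)(z)) · Π_{x∈B(Λ)}t_{a_{k+1}(Lᵏ⁺¹ε)^{d−2}}(g(x) − (Q_{k+1}(Ã)φ₀)(x))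
= Π_{z∈Λ}t_{a_{k+2}(Lᵏ⁺²ε)^{d−2}}(ψ(z) − (Q_{k+2}(Ã)φ₀)(z))` — r14's (I.2.12) block by block
(`integral_blockKernel_mul_prod_rtKernel` over `Λ × {0,…,L−1}^d`), `Q(Ã)Q_{k+1}(Ã) = Q_{k+2}(Ã)` (`avgQ_avgQk`) and the
precision bookkeeping `compPrec_model`. [cite: Balaban1982Higgs1, (2.12)–(2.14) p.609] [cite: Balaban1982Higgs2, (3.22) p.588] -/
theorem stepKer_integral_kerK (ha : 0 < a) (hL : 1 < P.L) {k : ℕ} (hk : k + 1 < P.K) (Λ : Finset (HiggsLattice.Site P (k + 2)))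
    (ψ : HiggsLattice.ScalarField P (k + 2) N) (φ₀ : HiggsLattice.ScalarField P 0 N) :
    ∫ g : BlkIdx Λ → V N, stepKer C a A Λ ψ (place Λ g) * kerK C a A (k + 1) (HiggsLattice.blockSet Λ) (place Λ g) φ₀
      = kerK C a A (k + 2) Λ ψ φ₀ := by
  have hL' : (1 : ℝ) < P.L := by exact_mod_cast hL
  set α : ℝ := prec a (P.mesh (k + 2)) P.d with hα
  set β : ℝ := precAt P a (k + 1) with hβ
  set w : ℝ := ((P.L : ℝ) ^ P.d)⁻¹ with hw
  have hαpos : 0 < α := prec_pos ha (P.mesh_pos (k + 2)) P.d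
  have hβpos : 0 < β := precAt_pos ha hL (Nat.le_add_left 1 k)
  set u : BlkIdx Λ → (V N ≃ₗᵢ[ℝ] V N) := fun p => uQ C A (p.1.1, p.2) with hu
  set c : BlkIdx Λ → V N := fun p => avgQk C A (k + 1) φ₀ (blockSite p.1.1 p.2) with hc
  set ψ' : ↥Λ → V N := fun z => ψ z.1 with hψ'
  -- the integrand in r14's product-model letters
  have hint : ∀ g : BlkIdx Λ → V N,
      stepKer C a A Λ ψ (place Λ g) * kerK C a A (k + 1) (HiggsLattice.blockSet Λ) (place Λ g) φ₀
        = (∏ z : ↥Λ, rtKernel α (ψ' z - qAvg w u g z)) * ∏ p : BlkIdx Λ, rtKernel β (g p - c p) := by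
    intro g
    have h1 : stepKer C a A Λ ψ (place Λ g) = ∏ z : ↥Λ, rtKernel α (ψ' z - qAvg w u g z) := by
      unfold stepKer
      rw [← Finset.prod_coe_sort Λ]
      refine Finset.prod_congr rfl fun z _ => ?_
      rw [avgQ_place C A hk Λ g z]
    have h2 : kerK C a A (k + 1) (HiggsLattice.blockSet Λ) (place Λ g) φ₀ = ∏ p : BlkIdx Λ, rtKernel β (g p - c p) := by
      unfold kerK
      rw [prod_blockSet_eq hk]
      refine Finset.prod_congr rfl fun p _ => ?_
      rw [place_blockSite hk Λ g p.1 p.2]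
    rw [h1, h2]
  simp_rw [hint]
  rw [integral_blockKernel_mul_prod_rtKernel hαpos hβpos w u c ψ']
  -- the right side: precision and `Q(Ã)Q_{k+1}(Ã) = Q_{k+2}(Ã)`
  unfold kerK
  rw [← Finset.prod_coe_sort Λ]
  refine Finset.prod_congr rfl fun z _ => ?_
  have hprec : compPrec α β w (Fintype.card (Fin P.d → Fin P.L)) = precAt P a (k + 2) := by
    rw [hα, hβ, hw, precAt, precAt]
    exact compPrec_model ha hL (Nat.le_add_left 1 k)
  have havg : w • ∑ r : Fin P.d → Fin P.L, u (z, r) (c (z, r)) = avgQk C A (k + 2) φ₀ z.1 := by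
    rw [hw, hu, hc]
    show (((P.L : ℝ) ^ P.d)⁻¹) • ∑ r : Fin P.d → Fin P.L,
        uQ C A (z.1, r) (avgQk C A (k + 1) φ₀ (blockSite z.1 r)) = avgQk C A (k + 2) φ₀ z.1
    rw [qAvg_uQ_eq_avgQ C A hk z.1 (avgQk C A (k + 1) φ₀), HiggsAveragingCompose.avgQ_avgQk]
  rw [hprec, havg]

/-- **THE LOCALIZED COMPOSITION LAW (I.2.16) — the step (3.21) → (3.22)**: for `a > 0`, `L > 1` and `k+1 ≤` the number
of scales of the lattice family, composing the `k+1` single-step renormalization kernels localized in the tower over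
`Λ ⊂ T⁽ᵏ⁺¹⁾` (intermediate fields integrated over `Bᵏ(Λ), …, B(Λ)`) gives the one-stroke kernel of (3.23) on `Λ`:
`chain k Λ ψ φ₀ = Π_{y∈Λ} t_{a_{k+1}(Lᵏ⁺¹ε)^{d−2}}(ψ(y) − (Q_{k+1}(Ã)φ₀)(y))`. [cite: Balaban1982Higgs2, (3.21)–(3.23) p.588]
[cite: Balaban1982Higgs1, (2.16) p.609] -/
theorem chain_eq_kerK (ha : 0 < a) (hL : 1 < P.L) :
    ∀ (k : ℕ), k + 1 ≤ P.K → ∀ (Λ : Finset (HiggsLattice.Site P (k + 1))) (ψ : HiggsLattice.ScalarField P (k + 1) N) (φ₀ : HiggsLattice.ScalarField P 0 N),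
      chain C a A k Λ ψ φ₀ = kerK C a A (k + 1) Λ ψ φ₀
  | 0, _, Λ, ψ, φ₀ => by rw [chain_zero, kerK_one hL]
  | k + 1, hk, Λ, ψ, φ₀ => by
      rw [chain_succ]
      have ih := chain_eq_kerK ha hL k (Nat.le_of_succ_le hk)
      simp_rw [ih]
      exact stepKer_integral_kerK ha hL hk Λ ψ φ₀

end Kernels

/-! ## §3  The knit with (3.23): its kernels ARE the compositions of the localized single-step transformations -/

section Knit

variable {K : ℕ} (R : Regions P K) (C : HiggsLattice.ChargeData N) (a : ℝ) (A : HiggsLattice.VecField P 0) (msq : ℝ)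

/-- The kernel product of gen 4's (3.23) integrand, region by region: `Π_{s∈⨆Λ_k} t_{a_k(Lᵏε)^{d−2}}(φ_k(s) − (Q_k(Ã)φ₀)(s))
= Π_{k=1}^{K} kerK k Λ_k (φ_k↾Λ_k) φ₀`. [cite: Balaban1982Higgs2, (3.23) p.588] -/
theorem prod_blockSite_eq_prod_kerK (Φ : Cfg R N) (φ₀ : HiggsLattice.ScalarField P 0 N) :
    ∏ s : R.BlockSite, rtKernel (precAt P a (R.lvl s)) (Φ.2 s - qMean C A R φ₀ s)
      = ∏ j : Fin K, kerK C a A (j.val + 1) (R.block j) (extL R j (resL R j Φ)) φ₀ := by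
  rw [Fintype.prod_sigma]
  refine Finset.prod_congr rfl fun j _ => ?_
  unfold kerK
  rw [← Finset.prod_coe_sort (R.block j)]
  refine Finset.prod_congr rfl fun y _ => ?_
  rw [qMean_eq_avgQk]
  have hext : extL R j (resL R j Φ) y.1 = Φ.2 ⟨j, y⟩ := by
    unfold extL resL
    rw [dif_pos y.2]
  rw [hext]

/-- **(3.23)'s INTEGRAND IS THE PRODUCT OF THE LOCALIZED COMPOSITIONS**: for `K ≤` the number of scales of the lattice
family, `a > 0`, `L > 1`: `dens(Φ,φ₀↾Λ₅⁽⁰⁾) = Π_{k=1}^{K} chain (k−1) Λ_k (φ_k↾Λ_k) φ₀ · exp(−½⟨φ₀,(−Δ^ε_{Ã} + m²)φ₀⟩)` with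
`φ₀` re-glued from `Φ`'s `Λ₅⁽⁰⁾ᶜ`-part and the integration variable — the step (3.21) → (3.22)/(3.23) on the concrete
carrier. [cite: Balaban1982Higgs2, (3.21)–(3.23) p.588] -/
theorem dens_eq_prod_chain (hK : K ≤ P.K) (ha : 0 < a) (hL : 1 < P.L) (Φ : Cfg R N) (u : InCfg R N) :
    B2Eq337ScalarIntegration.dens R C a A msq Φ u
      = (∏ j : Fin K, chain C a A j.val (R.block j) (extL R j (resL R j Φ)) (field R Φ.1 u))
          * gField C A msq (field R Φ.1 u) := by
  unfold B2Eq337ScalarIntegration.dens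
  rw [prod_blockSite_eq_prod_kerK]
  congr 1
  refine Finset.prod_congr rfl fun j _ => ?_
  exact (chain_eq_kerK ha hL j.val (le_trans j.isLt hK) _ _ _).symm

/-- **(3.25)'s left side as the integral of the composed localized single-step kernels**:
`Z(Ã)e^{−½⟨Φ,Δ(Ã)Φ⟩} = F325(Φ) = ∫dφ₀↾Λ₅⁽⁰⁾ Π_{k=1}^{K} chain (k−1) Λ_k (φ_k↾Λ_k) φ₀ · e^{−½⟨φ₀,(−Δ_{Ã}+m²)φ₀⟩}`.
[cite: Balaban1982Higgs2, (3.22)–(3.25) pp.588–589] -/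
theorem F325_eq_integral_chain (hK : K ≤ P.K) (ha : 0 < a) (hL : 1 < P.L) (Φ : Cfg R N) :
    F325 R C a A msq Φ
      = ∫ u : InCfg R N, (∏ j : Fin K, chain C a A j.val (R.block j) (extL R j (resL R j Φ)) (field R Φ.1 u))
          * gField C A msq (field R Φ.1 u) := by
  unfold F325
  refine integral_congr_ae (Filter.Eventually.of_forall fun u => ?_)
  exact dens_eq_prod_chain R C a A msq hK ha hL Φ u

end Knit

/-! ## §4  (v1.1) Normalization of the localized kernels: (I.2.8) / (3.32) p. 590 for `kerK` and `chain` -/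

section Normalization

variable (C : HiggsLattice.ChargeData N) (a : ℝ) (A : HiggsLattice.VecField P 0)

/-- A field on the sites of `Λ` (given on the subtype) SPREAD on `T⁽ᵏ⁾` (`0` elsewhere; `kerK … Λ` reads `Λ` only) — the
integration variable `φ_k↾_Λ` of (3.32). [cite: Balaban1982Higgs2, (3.32) p.590] -/
def spread {k : ℕ} (Λ : Finset (HiggsLattice.Site P k)) (h : ↥Λ → V N) : HiggsLattice.ScalarField P k N :=
  fun y => if hy : y ∈ Λ then h ⟨y, hy⟩ else 0

/-- On `Λ` the spread field is the given one. [cite: Balaban1982Higgs2, (3.32) p.590] -/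
theorem spread_apply_mem {k : ℕ} (Λ : Finset (HiggsLattice.Site P k)) (h : ↥Λ → V N) (y : ↥Λ) :
    spread Λ h y.1 = h y := by
  unfold spread
  rw [dif_pos y.2]

/-- `kerK` of a spread field IS r14's product-model kernel `B1RT.blockKernel` over the sites of `Λ` (block averages
`(Q_k(Ã)·)(y)`, `y ∈ Λ`). [cite: Balaban1982Higgs1, (2.5)/(2.10) pp.608–609] [cite: Balaban1982Higgs2, (3.23) p.588] -/
theorem kerK_spread (k : ℕ) (Λ : Finset (HiggsLattice.Site P k)) (h : ↥Λ → V N) (φ₀ : HiggsLattice.ScalarField P 0 N) :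
    kerK C a A k Λ (spread Λ h) φ₀
      = blockKernel (precAt P a k) (fun (φ : HiggsLattice.ScalarField P 0 N) (y : ↥Λ) => avgQk C A k φ y.1) h φ₀ := by
  unfold kerK
  rw [blockKernel_eq, ← Finset.prod_coe_sort Λ]
  refine Finset.prod_congr rfl fun y _ => ?_
  rw [spread_apply_mem]

/-- **(I.2.8) / (3.32) for the localized one-stroke kernel**: `∫dφ_k↾_Λ Π_{y∈Λ}t_{a_k(Lᵏε)^{d−2}}(φ_k(y) − (Q_k(Ã)φ₀)(y)) = 1`
(`a > 0`, `L > 1`, `k ≥ 1`; r14's `B1RT.integral_blockKernel`). [cite: Balaban1982Higgs2, (3.32) p.590]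
[cite: Balaban1982Higgs1, (2.8) p.609] -/
theorem integral_kerK_spread (ha : 0 < a) (hL : 1 < P.L) {k : ℕ} (hk : 1 ≤ k) (Λ : Finset (HiggsLattice.Site P k))
    (φ₀ : HiggsLattice.ScalarField P 0 N) :
    ∫ h : ↥Λ → V N, kerK C a A k Λ (spread Λ h) φ₀ = 1 := by
  simp_rw [kerK_spread]
  exact integral_blockKernel (precAt_pos ha hL hk) _ φ₀

/-- **(3.32) for the COMPOSED localized transformations**: `∫dφ_{k+1}↾_Λ (chain k Λ φ_{k+1} φ₀) = 1` for `k+1 ≤` the number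
of scales — *"using the normalization properties of the renormalization transformations"* (p. 590).
[cite: Balaban1982Higgs2, (3.32) p.590] [cite: Balaban1982Higgs1, (2.8), (2.16) p.609] -/
theorem integral_chain_spread (ha : 0 < a) (hL : 1 < P.L) (k : ℕ) (hk : k + 1 ≤ P.K)
    (Λ : Finset (HiggsLattice.Site P (k + 1))) (φ₀ : HiggsLattice.ScalarField P 0 N) :
    ∫ h : ↥Λ → V N, chain C a A k Λ (spread Λ h) φ₀ = 1 := by
  simp_rw [chain_eq_kerK ha hL k hk]
  exact integral_kerK_spread C a A ha hL (Nat.le_add_left 1 k) Λ φ₀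

end Normalization

end Literature.MathematicalPhysics.QuantumFieldTheory.Balaban1983to89.B2Eq322Composition

end
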